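import Summits.HodgeConjecture.HodgeConjecture.Theorems.MarkmanPartnerTransportPicardThreeK3SquaresCycleInducedSector
import Summits.HodgeConjecture.HodgeConjecture.Theorems.MarkmanPartnerTransportPicardThreeK3SquaresSymplecticLocus
import Literature.AlgebraicGeometry.HodgeTheory.DiagonalSymmetryStability
import Literature.AlgebraicGeometry.HodgeTheory.MotivatedClassesRationalSpan

/-!
# Squares of surfaces — the Hodge conjecture for `S × S` from a FINITE algebraic spanning family of
# `End_Hdg(T(S))`, and the rung SQ-AUT (pull-backs along endomorphisms of `S`)

Chapter «SQ-END» of cell hodge-nonav (planner p1 g29, memo `ROUTE-P1AB`, Sketch sha16 88d3404fc35a91e8,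
referee PASS g44), landed as tree theorems (ask A34-a). For EVERY smooth projective complex surface `S`:

* `corrFst_mem_algebraicClasses_one` — the action `[γ]_* = pr₁_*(pr₂^*(·) ∪ γ)` of an ALGEBRAIC class
  `γ ∈ N²H⁴(S × S)` maps `N¹H²(S)` into itself (Lefschetz `(1,1)`).
* `hodgeConjectureFor_square_of_family` — **if `End_Hdg(T(S))` is contained, on `T = (N¹H²)^⊥`, in
  `ℂ·id + Σ_k ℂ·e_k` for finitely many `N`-stable endomorphisms `e_k` induced by ALGEBRAIC classes on
  `S × S`, then `HodgeConjectureFor 4 (S ⊗ S)`.** RE-BASED (memo §B (0)) on the tree's general sector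
  theorem `MarkmanPartnerTransport.CycleInducedSector.hodgeConjectureFor_square_of_cycleInducedSector`:
  the witness `g = a·Q + Σ_k b_k·e_k`, `Q` the transcendental projector, itself induced by an algebraic
  class (`MarkmanPartnerTransport.SymplecticLocus.exists_corr_transcendentalProjector`).
* `hodgeConjectureFor_square_of_algebraicCorrespondences` — the same with `e_k = [γ_k]_*`.
* `graph_mem_algebraicClasses`, `corrFst_graph` — the graph class `(𝟙, σ)_* 1` of an endomorphism
  `σ : X ⟶ X` is algebraic and acts as `σ^*` (every dimension and degree).
* `hodgeConjectureFor_square_of_endomorphisms` (SQ-AUT) — `End_Hdg(T(S)) ⊆ ℂ·id + Σ_k ℂ·σ_k^*|_T` for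
  finitely many endomorphisms `σ_k` of `S` ⟹ `HodgeConjectureFor 4 (S ⊗ S)`.

Consumer: `Theorems/PgOneCyclotomicSquares` (the KERNEL rung PG1-CM-AUT: a `p_g = 1` surface with a
cyclotomic self-map and `rk T = φ(n)`), and through it the crux `MarkmanPartnerTransport.PicardThreeK3Squares`
(stmt-HodgeConjecture-19652; prover seat hodge-nonav-19652-p1 g4, `--supports`). No named-fact
hypothesis, no definition, no sorry (the memo's `Prop` shapes A5 are spelled out in the hypotheses).

References: Varesco, *Hodge similarities, algebraic classes, and Kuga–Satake varieties*, Math. Z. 305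
(2023) §2 p. 8 («HC for `X²` ⟺ every element of `End_Hdg(T(X))` is algebraic»); Huybrechts, *Motives of
isogenous K3 surfaces* (2019) §1; Voisin, *Hodge Theory I* §11.3.3, Thm. 11.30; André, *Pour une
théorie inconditionnelle des motifs* (1996) §2.1 p. 15 (graph classes); Fulton, *Young Tableaux*, App. B.
-/

set_option linter.dupNamespace false

noncomputable section

namespace Summit.HodgeConjecture.HodgeConjecture.Theorems.PgOneCyclotomicSquares

open scoped Manifold
open CategoryTheory MonoidalCategory CartesianMonoidalCategory
open CategoryTheory.Limits
open Literature.AlgebraicGeometry Literature.AlgebraicGeometry.Motives Literature.AlgebraicGeometry.HodgeTheory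
open Literature.AlgebraicTopology.SingularHomology
open Summit.HodgeConjecture.HodgeConjecture.Theorems
open Summit.HodgeConjecture.HodgeConjecture.Theorems.NikulinTwinTransport
open Summit.HodgeConjecture.HodgeConjecture.Theorems.NikulinTwinTransport.SquareGlueFree
open Summit.HodgeConjecture.HodgeConjecture.Theorems.MarkmanPartnerTransport

variable {S : SchemeOver ℂ}

/-- `Corr[μ, hS ; γ, y] = pr₁_*(pr₂^* y ∪ γ)` on `H²(S(ℂ); ℂ)` (the tree's shape). Local notation only. -/
local notation3 (prettyPrint := false) "Corr[" μ ", " hS " ; " γ ", " y "]" =>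
  complexGysin μ (IsSmoothProjective.tensor_holds hS hS) hS
    (SemiCartesianMonoidalCategory.fst _ _) (rfl : 2 * 1 + 2 * 2 + 2 * 2 = 2 * 1 + 2 * (2 + 2))
    (cupProduct (rfl : 2 * 1 + 2 * 2 = 2 * 1 + 2 * 2)
      (complexBetti.map (SemiCartesianMonoidalCategory.snd _ _) (2 * 1) y) γ)

/-! ### §1 Algebraic correspondences preserve `N¹H²` -/

/-- **The action `[γ]_* = pr₁_*(pr₂^*(·) ∪ γ)` of an ALGEBRAIC class `γ ∈ N²H⁴((S × S)(ℂ); ℂ)` maps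
`N¹H²(S)` into itself.** Both `N²H⁴(S × S)` and `N¹H²(S)` are the `ℂ`-spans of their rational members
(`span_isRationalClass_mem_algebraicClasses`); for `γ` and `d` rational, `u • [γ]_* d` is rational
(`exists_smul_complexGysin_isRationalClass`, `u ≠ 0`) and of type `(1,1)` (`isOfHodgeType_corrFst`,
algebraic classes being of Hodge type), hence in `N¹` by Lefschetz `(1,1)`.
[cite: VoisinHodgeI2002, Thm. 11.30 and Lemma 11.41] [cite: Andre1996Motifs, §2.1 Déf. 1 (p. 14)] -/
theorem corrFst_mem_algebraicClasses_one (μ : OrientationFamily) (hS : IsSmoothProjective 2 S)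
    {γ : complexBetti (S ⊗ S) (2 * 2)} (hγ : γ ∈ algebraicClasses (S ⊗ S) 2)
    {d : complexBetti S (2 * 1)} (hd : d ∈ algebraicClasses S 1) :
    Corr[μ, hS ; γ, d] ∈ algebraicClasses S 1 := by
  classical
  have hI := hodgePQ_independent_of_hodgeModel_holds
  have hdR : ∀ (E : Type) [NormedAddCommGroup E] [NormedSpace ℂ E] [FiniteDimensional ℂ E],
      Literature.NumberTheory.Transcendental.exists_deRhamIsoFamily 𝓘(ℝ, E) :=
    fun E _ _ _ ↦ Literature.NumberTheory.Transcendental.exists_deRhamIsoFamily_holds E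
  have hSS := IsSmoothProjective.tensor_holds hS hS
  obtain ⟨A⟩ := nonempty_hodgeModel_holds (n := 2) (X := S) hS
  obtain ⟨B⟩ := nonempty_hodgeModel_holds (n := 2 + 2) (X := S ⊗ S) hSS
  set N : Submodule ℂ (complexBetti S (2 * 1)) := algebraicClasses S 1 with hNdef
  have hN11 : ∀ d ∈ N, IsOfHodgeType 2 S (2 * 1) 1 1 d :=
    fun d hd ↦ isOfHodgeType_of_mem_algebraicClasses_of_isSmoothProjective hS 1 hd
  have hL11 : ∀ c : complexBetti S (2 * 1), IsRationalClass c → IsOfHodgeType 2 S (2 * 1) 1 1 c → c ∈ N :=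
    fun c hc h11 ↦ lefschetzOneOne_rational_holds hS c hc h11
  obtain ⟨u, hu0, hu⟩ := exists_smul_complexGysin_isRationalClass μ hSS hS (fst S S)
    (rfl : 2 * 1 + 2 * 2 + 2 * 2 = 2 * 1 + 2 * (2 + 2))
  -- rational `γ`, rational `d`
  have key : ∀ g : complexBetti (S ⊗ S) (2 * 2), IsRationalClass g → g ∈ algebraicClasses (S ⊗ S) 2 →
      ∀ x : complexBetti S (2 * 1), IsRationalClass x → x ∈ N → Corr[μ, hS ; g, x] ∈ N := by
    intro g hgQ hgalg x hxQ hxN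
    have hgT : IsOfHodgeType (2 + 2) (S ⊗ S) (2 * 2) 2 2 g :=
      isOfHodgeType_of_mem_algebraicClasses_of_isSmoothProjective hSS 2 hgalg
    have h1 : IsRationalClass (u • Corr[μ, hS ; g, x]) :=
      hu _ (IsRationalClass.cup _ (IsRationalClass.map _ hxQ) hgQ)
    have h2 : IsOfHodgeType 2 S (2 * 1) 1 1 (u • Corr[μ, hS ; g, x]) :=
      (isOfHodgeType_corrFst hI hdR μ hS hS B A (rfl : 2 * 1 + 2 * 2 = 2 * 1 + 2 * 2)
        (rfl : 2 * 1 + 2 * 2 + 2 * 2 = 2 * 1 + 2 * (2 + 2)) hgT (rfl : 1 + 2 = 1 + 2) (rfl : 1 + 2 = 1 + 2)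
        (hN11 x hxN)).smul u
    have h4 : Corr[μ, hS ; g, x] = u⁻¹ • (u • Corr[μ, hS ; g, x]) := by
      rw [smul_smul, inv_mul_cancel₀ hu0, one_smul]
    rw [h4]
    exact Submodule.smul_mem _ _ (hL11 _ h1 h2)
  -- rational `γ`, any `d ∈ N`
  have key2 : ∀ g : complexBetti (S ⊗ S) (2 * 2), IsRationalClass g → g ∈ algebraicClasses (S ⊗ S) 2 →
      ∀ x ∈ N, Corr[μ, hS ; g, x] ∈ N := by
    intro g hgQ hgalg x hxN
    have hx' : x ∈ Submodule.span ℂ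
        {c : complexBetti S (2 * 1) | IsRationalClass c ∧ c ∈ algebraicClasses S 1} := by
      rw [span_isRationalClass_mem_algebraicClasses hS 1]
      exact hxN
    refine Submodule.span_induction (p := fun x _ ↦ Corr[μ, hS ; g, x] ∈ N) ?_ ?_ ?_ ?_ hx'
    · rintro x ⟨hxQ, hxN⟩
      exact key g hgQ hgalg x hxQ hxN
    · simp only [map_zero, LinearMap.zero_apply]
      exact Submodule.zero_mem _
    · intro x y _ _ hx hy
      simp only [map_add, LinearMap.add_apply]
      exact Submodule.add_mem _ hx hy
    · intro t x _ hx
      simp only [map_smul, LinearMap.smul_apply]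
      exact Submodule.smul_mem _ _ hx
  -- any `γ ∈ N²`
  have hγ' : γ ∈ Submodule.span ℂ
      {c : complexBetti (S ⊗ S) (2 * 2) | IsRationalClass c ∧ c ∈ algebraicClasses (S ⊗ S) 2} := by
    rw [span_isRationalClass_mem_algebraicClasses hSS 2]
    exact hγ
  refine Submodule.span_induction (p := fun g _ ↦ Corr[μ, hS ; g, d] ∈ N) ?_ ?_ ?_ ?_ hγ'
  · rintro g ⟨hgQ, hgalg⟩
    exact key2 g hgQ hgalg d hd
  · simp only [map_zero]
    exact Submodule.zero_mem _
  · intro x y _ _ hx hy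
    simp only [map_add]
    exact Submodule.add_mem _ hx hy
  · intro t x _ hx
    simp only [map_smul]
    exact Submodule.smul_mem _ _ hx

/-! ### §2 The Hodge conjecture for `S ⊗ S` from a finite spanning family -/

/-- **SQ-END — the surface-square closure rule with a finite algebraic spanning family.** For EVERY
smooth projective complex surface `S` and orientation family `μ`: if every rational type-preserving
endomorphism `f` of `H²(S)` killing `N¹H²` with image cup-orthogonal to `N¹H²` is, on `T = (N¹H²)^⊥`,
`a·id + Σ_{k<m} b_k·e_k` (`a, b_k ∈ ℂ`) for endomorphisms `e_k` each induced by an ALGEBRAIC class on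
`S × S` (`e_k = [γ_k]_*`), then `HodgeConjectureFor 4 (S ⊗ S)`. Proof: the tree's general-sector theorem
`CycleInducedSector.hodgeConjectureFor_square_of_cycleInducedSector` with the witness
`g = a·Q + Σ_k b_k·e_k`, `Q = [Δ − κ⁻¹Σᵢ pr₁^*dᵢ ∪ pr₂^*dᵢ^∨]_*` the transcendental projector
(`SymplecticLocus.exists_corr_transcendentalProjector`: kills `N¹`, fixes `T` pointwise); `g` is
`N`-stable (`corrFst_mem_algebraicClasses_one`) and induced by the algebraic class `a·γ_Q + Σ b_k·γ_k`
(linearity of `γ ↦ [γ]_*`). The cases `m = 0`, `m = 1` are the tree's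
`hodgeConjectureFor_square_of_hodgeEndomorphisms_scalar` ∕ `hodgeConjectureFor_square_of_sector`.
[cite: Varesco2023, §2 (p. 8)] [cite: VoisinHodgeI2002, Thm. 11.30 and Lemma 11.41] -/
theorem hodgeConjectureFor_square_of_family (μ : OrientationFamily) (hS : IsSmoothProjective 2 S)
    {m : ℕ} (e : Fin m → (complexBetti S (2 * 1) →ₗ[ℂ] complexBetti S (2 * 1)))
    (hγe : ∀ k, ∃ γ ∈ algebraicClasses (S ⊗ S) 2, ∀ y : complexBetti S (2 * 1), e k y = Corr[μ, hS ; γ, y])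
    (hU : ∀ (f : complexBetti S (2 * 1) →ₗ[ℂ] complexBetti S (2 * 1)),
      (∀ y, IsRationalClass y → IsRationalClass (f y)) →
      (∀ (i j : ℕ) y, IsOfHodgeType 2 S (2 * 1) i j y → IsOfHodgeType 2 S (2 * 1) i j (f y)) →
      (∀ d ∈ algebraicClasses S 1, f d = 0) →
      (∀ y : complexBetti S (2 * 1), ∀ d ∈ algebraicClasses S 1,
        cupProduct (rfl : 2 * 1 + 2 * 1 = 2 * 2) (f y) d = 0) →
      ∃ (a : ℂ) (b : Fin m → ℂ), ∀ y : complexBetti S (2 * 1),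
        (∀ d ∈ algebraicClasses S 1, cupProduct (rfl : 2 * 1 + 2 * 1 = 2 * 2) y d = 0) →
        f y = a • y + ∑ k, b k • e k y) :
    HodgeConjectureFor 4 (S ⊗ S) := by
  classical
  choose γ hγalg hγ using hγe
  have he_N : ∀ k, ∀ d ∈ algebraicClasses S 1, e k d ∈ algebraicClasses S 1 := fun k d hd ↦ by
    rw [hγ k d]
    exact corrFst_mem_algebraicClasses_one μ hS (hγalg k) hd
  obtain ⟨Q, γQ, hγQalg, hQ, hQN, hQT⟩ := SymplecticLocus.exists_corr_transcendentalProjector μ hS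
  refine CycleInducedSector.hodgeConjectureFor_square_of_cycleInducedSector μ hS
    fun f hf₁ hf₂ hf₃ hf₄ ↦ ?_
  obtain ⟨a, b, hab⟩ := hU f hf₁ hf₂ hf₃ hf₄
  refine ⟨a • Q + ∑ k, b k • e k, fun d hd ↦ ?_, ⟨a • γQ + ∑ k, b k • γ k, ?_, fun y ↦ ?_⟩,
    fun y hy ↦ ?_⟩
  · simp only [LinearMap.add_apply, LinearMap.smul_apply, LinearMap.sum_apply, hQN d hd, smul_zero,
      zero_add]
    exact Submodule.sum_mem _ fun k _ ↦ Submodule.smul_mem _ _ (he_N k d hd)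
  · exact Submodule.add_mem _ (Submodule.smul_mem _ _ hγQalg)
      (Submodule.sum_mem _ fun k _ ↦ Submodule.smul_mem _ _ (hγalg k))
  · simp only [LinearMap.add_apply, LinearMap.smul_apply, LinearMap.sum_apply, map_add, map_smul,
      map_sum, hQ y, hγ]
  · rw [hab y hy, LinearMap.add_apply, LinearMap.smul_apply, LinearMap.sum_apply, hQT y hy]
    simp only [LinearMap.smul_apply]

/-- **SQ-END, correspondence form — the printed criterion «`End_Hdg(T(S))` algebraic ⇒ HC for `S²`»
(Varesco 2023 §2 p. 8, for K3) for EVERY smooth projective surface and a FINITE generating family.**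
If, for algebraic classes `γ₁, …, γ_m ∈ N²H⁴(S × S)`, every rational type-preserving endomorphism of
`H²(S)` killing `N¹H²` with image orthogonal to `N¹H²` is `a·id + Σ_k b_k·[γ_k]_*` on `T` (`a, b_k ∈ ℂ`),
then `HodgeConjectureFor 4 (S ⊗ S)`. [cite: Varesco2023, §2 (p. 8)] [cite: Huybrechts2019, §1] -/
theorem hodgeConjectureFor_square_of_algebraicCorrespondences (μ : OrientationFamily)
    (hS : IsSmoothProjective 2 S) {m : ℕ} (γ : Fin m → complexBetti (S ⊗ S) (2 * 2))
    (hγ : ∀ k, γ k ∈ algebraicClasses (S ⊗ S) 2)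
    (hU : ∀ (f : complexBetti S (2 * 1) →ₗ[ℂ] complexBetti S (2 * 1)),
      (∀ y, IsRationalClass y → IsRationalClass (f y)) →
      (∀ (i j : ℕ) y, IsOfHodgeType 2 S (2 * 1) i j y → IsOfHodgeType 2 S (2 * 1) i j (f y)) →
      (∀ d ∈ algebraicClasses S 1, f d = 0) →
      (∀ y : complexBetti S (2 * 1), ∀ d ∈ algebraicClasses S 1,
        cupProduct (rfl : 2 * 1 + 2 * 1 = 2 * 2) (f y) d = 0) →
      ∃ (a : ℂ) (b : Fin m → ℂ), ∀ y : complexBetti S (2 * 1),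
        (∀ d ∈ algebraicClasses S 1, cupProduct (rfl : 2 * 1 + 2 * 1 = 2 * 2) y d = 0) →
        f y = a • y + ∑ k, b k • Corr[μ, hS ; γ k, y]) :
    HodgeConjectureFor 4 (S ⊗ S) :=
  hodgeConjectureFor_square_of_family μ hS
    (fun k ↦ (complexGysin μ (IsSmoothProjective.tensor_holds hS hS) hS (fst S S)
        (rfl : 2 * 1 + 2 * 2 + 2 * 2 = 2 * 1 + 2 * (2 + 2))) ∘ₗ
      ((cupProduct (rfl : 2 * 1 + 2 * 2 = 2 * 1 + 2 * 2)).flip (γ k)) ∘ₗ (complexBetti.map (snd S S) (2 * 1)).hom)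
    (fun k ↦ ⟨γ k, hγ k, fun _ ↦ rfl⟩) hU

/-! ### §3 The graph class of an endomorphism acts as the pull-back -/

section Graph

variable {X : SchemeOver ℂ} {n : ℕ}

/-- **The graph class `Γ_σ := (𝟙, σ)_* 1 ∈ H²ⁿ((X ⊗ X)(ℂ); ℂ)` of an endomorphism `σ : X ⟶ X` is
algebraic** (tree `complexGysin_graph_one_mem_algebraicClasses`). [cite: Andre1996Motifs, §2.1 (p. 15)] -/
theorem graph_mem_algebraicClasses (μ : OrientationFamily) (hX : IsSmoothProjective n X) (σ : X ⟶ X)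
    (hdeg : 0 + 2 * (n + n) = 2 * n + 2 * n) :
    complexGysin μ hX (IsSmoothProjective.tensor_holds hX hX) (lift (𝟙 X) σ) hdeg
        (singularCohomology.one ℂ (ComplexPoints X)) ∈ algebraicClasses (X ⊗ X) n :=
  complexGysin_graph_one_mem_algebraicClasses μ μ.hasPoincareDuality hX
    (IsSmoothProjective.tensor_holds hX hX) σ

/-- **The graph class acts as the pull-back: `fst_*(snd^* w ∪ (𝟙, σ)_* 1) = σ^* w`** in every degree
(`g = (𝟙, σ)`: `snd^* w ∪ g_* 1 = g_*(g^* snd^* w) = g_*(σ^* w)` by the projection formula and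
`g ≫ snd = σ`; `fst_* g_* = (g ≫ fst)_* = 𝟙_* = id`) — the `f = σ` case of the tree's
`corrFst_diagonal` ∕ `corrClassAction_graph`, in the `complexGysin` spelling.
[cite: Andre1996Motifs, §2.1 (p. 15)] [cite: FultonYoungTableaux1997, Appendix B §B.1 (2), (5), (6)] -/
theorem corrFst_graph (μ : OrientationFamily) (hX : IsSmoothProjective n X) (σ : X ⟶ X) {j a : ℕ}
    (hja : j + 2 * n = a) (hab : a + 2 * n = j + 2 * (n + n)) (hdeg : 0 + 2 * (n + n) = 2 * n + 2 * n)
    (w : complexBetti X j) :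
    complexGysin μ (IsSmoothProjective.tensor_holds hX hX) hX (fst X X) hab
        (cupProduct hja (complexBetti.map (snd X X) j w)
          (complexGysin μ hX (IsSmoothProjective.tensor_holds hX hX) (lift (𝟙 X) σ) hdeg
            (singularCohomology.one ℂ (ComplexPoints X)))) = complexBetti.map σ j w := by
  have hμ := μ.hasPoincareDuality
  have hXX := IsSmoothProjective.tensor_holds hX hX
  -- projection formula for `g = (𝟙, σ)`
  rw [← complexGysin_cup hμ hX hXX (lift (𝟙 X) σ) (Nat.add_zero j)
    (show j + 2 * (n + n) = a + 2 * n by omega) hdeg hja, cupProduct_one]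
  -- `g^* snd^* = (g ≫ snd)^* = σ^*`
  have hgs : complexBetti.map (lift (𝟙 X) σ) j (complexBetti.map (snd X X) j w) =
      complexBetti.map σ j w := by
    rw [← CategoryTheory.comp_apply, ← complexBetti.map_comp, lift_snd]
  rw [hgs]
  -- `fst_* ∘ g_* = (g ≫ fst)_* = 𝟙_* = id`
  have hcomp := complexGysin_comp hμ hX hXX hX (lift (𝟙 X) σ) (fst X X)
    (show j + 2 * (n + n) = a + 2 * n by omega) hab
  rw [lift_fst, complexGysin_id hμ hX j] at hcomp
  have h := LinearMap.congr_fun hcomp (complexBetti.map σ j w)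
  rw [LinearMap.comp_apply, LinearMap.id_apply] at h
  exact h.symm

end Graph

/-! ### §4 SQ-AUT — spanning family given by pull-backs along endomorphisms of `S` -/

/-- Pull-backs along an endomorphism `σ : S ⟶ S` map `N¹H²(S)` into itself: `N` is the `ℂ`-span of its
RATIONAL classes (tree `exists_neronSeveri_gramBasis`), and for `d` rational of type `(1,1)` the class
`σ^* d` is rational (`IsRationalClass.map`) of type `(1,1)` (`IsOfHodgeType.map_endomorphism`), hence
in `N` by Lefschetz `(1,1)`. [cite: VoisinHodgeI2002, Thm. 11.30 and §7.3.2] -/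
theorem map_mem_algebraicClasses_one_of_endomorphism (hS : IsSmoothProjective 2 S) (σ : S ⟶ S)
    {d : complexBetti S (2 * 1)} (hd : d ∈ algebraicClasses S 1) :
    complexBetti.map σ (2 * 1) d ∈ algebraicClasses S 1 := by
  classical
  obtain ⟨r, b, M, hbQ, hbN, -, hspanN, -, -⟩ := exists_neronSeveri_gramBasis hS
  have hd' : d ∈ Submodule.span ℂ (Set.range b) := by rw [hspanN]; exact hd
  refine Submodule.span_induction (p := fun x _ ↦ complexBetti.map σ (2 * 1) x ∈ algebraicClasses S 1)
    ?_ ?_ ?_ ?_ hd'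
  · rintro _ ⟨i, rfl⟩
    have h11 : IsOfHodgeType 2 S (2 * 1) 1 1 (b i) :=
      isOfHodgeType_of_mem_algebraicClasses_of_isSmoothProjective hS 1 (hbN i)
    exact lefschetzOneOne_rational_holds hS _ (IsRationalClass.map _ (hbQ i)) (h11.map_endomorphism hS σ)
  · rw [map_zero]; exact Submodule.zero_mem _
  · intro x y _ _ hx hy
    rw [map_add]; exact Submodule.add_mem _ hx hy
  · intro t x _ hx
    rw [map_smul]; exact Submodule.smul_mem _ _ hx

/-- **SQ-AUT — the Hodge conjecture for `S ⊗ S` when `End_Hdg(T(S))` is spanned, on `T`, by the identity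
and finitely many pull-backs `σ_k^*` along endomorphisms `σ_k : S ⟶ S`** (automorphisms, or any
self-morphisms), for EVERY smooth projective complex surface `S`: the instance `e_k = σ_k^*` of
`hodgeConjectureFor_square_of_family` — `σ_k^*` is the action of the ALGEBRAIC graph class
(`corrFst_graph`, `graph_mem_algebraicClasses`). Special cases in print: K3 surfaces whose
transcendental lattice is a rank-one `ℚ(ζ_n) = ℚ[σ^*]`-module (CM by a non-symplectic automorphism;
Ramón Marí 2008 Thm 3.3 proves HC for all powers by a different route). [cite: RamonMari2008, Thm. 3.3]
[cite: Varesco2023, §2 (p. 8)] [cite: Andre1996Motifs, §2.1 (p. 15)] -/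
theorem hodgeConjectureFor_square_of_endomorphisms (hS : IsSmoothProjective 2 S) {m : ℕ}
    (σ : Fin m → (S ⟶ S))
    (hU : ∀ (f : complexBetti S (2 * 1) →ₗ[ℂ] complexBetti S (2 * 1)),
      (∀ y, IsRationalClass y → IsRationalClass (f y)) →
      (∀ (i j : ℕ) y, IsOfHodgeType 2 S (2 * 1) i j y → IsOfHodgeType 2 S (2 * 1) i j (f y)) →
      (∀ d ∈ algebraicClasses S 1, f d = 0) →
      (∀ y : complexBetti S (2 * 1), ∀ d ∈ algebraicClasses S 1,
        cupProduct (rfl : 2 * 1 + 2 * 1 = 2 * 2) (f y) d = 0) →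
      ∃ (a : ℂ) (b : Fin m → ℂ), ∀ y : complexBetti S (2 * 1),
        (∀ d ∈ algebraicClasses S 1, cupProduct (rfl : 2 * 1 + 2 * 1 = 2 * 2) y d = 0) →
        f y = a • y + ∑ k, b k • complexBetti.map (σ k) (2 * 1) y) :
    HodgeConjectureFor 4 (S ⊗ S) := by
  refine hodgeConjectureFor_square_of_family complexOrientationFamily hS
    (fun k ↦ (complexBetti.map (σ k) (2 * 1)).hom) (fun k ↦ ?_) hU
  exact ⟨_, graph_mem_algebraicClasses complexOrientationFamily hS (σ k) (rfl : 0 + 2 * (2 + 2) = 2 * 2 + 2 * 2),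
    fun y ↦ (corrFst_graph complexOrientationFamily hS (σ k) (rfl : 2 * 1 + 2 * 2 = 2 * 1 + 2 * 2)
      (rfl : 2 * 1 + 2 * 2 + 2 * 2 = 2 * 1 + 2 * (2 + 2)) (rfl : 0 + 2 * (2 + 2) = 2 * 2 + 2 * 2) y).symm⟩

end Summit.HodgeConjecture.HodgeConjecture.Theorems.PgOneCyclotomicSquares

end
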